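import Literature.MathematicalPhysics.QuantumLattice.HubbardNNNHoppingEnergyDensityParticleHole
import Literature.MathematicalPhysics.QuantumLattice.HubbardTorus2DEnergyDensityConvex
import HarnessLib

/-!
# The energy density minus `(U/2) n` is symmetric about half filling and minimal there

Family `hubbard` (topic `MathematicalPhysics/QuantumLattice`). For the repulsive (`U ≥ 0`) Hubbard
model on the square lattice (`t' = 0`) the thermodynamic-limit ground-state energy density
`e(n) = energyDensity2D t U n` is CONVEX in the density (`convexOn_energyDensity2D`, Ruelle (1969)
§3.3) and PARTICLE–HOLE SYMMETRIC, `e(n) = e(2 - n) + U (n - 1)` (`energyDensity2D_particleHole`,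
Lieb–Wu (2003) §1 eq. (3)). Hence the shifted density

  `g(n) = e(n) - (U/2) n`

is convex on `[0, 2)` and symmetric about `n = 1` (`g(2 - n) = g(n)`), so it is non-increasing on
`(0, 1]`, non-decreasing on `[1, 2)` and minimal at half filling. This is the thermodynamic-limit
form of Lieb–Wu's `μ₊ + μ₋ = U` (Physica A 321 (2003) §7: "E(N) = N_a e(N/N_a) and e is a convex
function … we learn from [the hole–particle identity] that μ₊ + μ₋ = U"): the chemical potential is
`≤ U/2` below half filling and `≥ U/2` above. Read as TRANSPORT INEQUALITIES for certified bounds: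

* `energyDensity2D_ge_at_one_add` — `e(1) + (U/2)(n - 1) ≤ e(n)` for all `0 < n < 2`: a certified
  LOWER bound at half filling is transported to every density at the price `(U/2)|1 - n|`;
* `energyDensity2D_sub_le_of_le_of_le_one` — for `0 < x ≤ a ≤ 1`: `e(a) - (U/2)(a - x) ≤ e(x)`
  (a lower bound at `a` moves DOWN in density towards `x`; an upper bound at `x` moves UP towards
  half filling), and the mirror statement `energyDensity2D_sub_le_of_one_le_of_le` on `[1, 2)`.

Everything is proved; no definitions; no numerical input.

## References

* E. H. Lieb, F. Y. Wu, Physica A 321 (2003) 1–27, §1 eq. (3) and §7 (convexity of `e`,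
  `μ₊ + μ₋ = U`). [cite: LiebWuPhysicaA2003, §7]
* D. Ruelle, *Statistical Mechanics: Rigorous Results* (1969), §3.3–§3.4 (existence and convexity
  of the limiting energy density). [cite: Ruelle1969, §3.3]
-/

noncomputable section

open Set

namespace Literature.MathematicalPhysics.QuantumLattice

namespace ThermodynamicLimit

/-- **Symmetry about half filling**: `g(2 - n) = g(n)` for `g(n) = e(n) - (U/2) n`, `0 < n < 2`,
`U ≥ 0` (the particle–hole identity `e(n) = e(2 - n) + U(n - 1)` rearranged).
[cite: LiebWuPhysicaA2003, §1 eq. (3)] -/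
theorem energyDensity2D_sub_half_mul_two_sub (t : ℝ) {U : ℝ} (hU : 0 ≤ U) {n : ℝ} (hn0 : 0 < n)
    (hn2 : n < 2) :
    energyDensity2D t U (2 - n) - U / 2 * (2 - n) = energyDensity2D t U n - U / 2 * n := by
  have h := energyDensity2D_particleHole t hU hn0 hn2
  linarith

/-- **Convexity of `g(n) = e(n) - (U/2) n` on `[0, 2)`** (`e` convex, the shift linear).
[cite: Ruelle1969, §3.3] -/
theorem convexOn_energyDensity2D_sub_half_mul (t : ℝ) {U : ℝ} (hU : 0 ≤ U) :
    ConvexOn ℝ (Ico (0 : ℝ) 2) (fun n => energyDensity2D t U n - U / 2 * n) := by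
  refine ⟨convex_Ico 0 2, fun x hx y hy a b ha hb hab => ?_⟩
  have h := (convexOn_energyDensity2D t hU).2 hx hy ha hb hab
  simp only [smul_eq_mul] at h ⊢
  have e : a * (energyDensity2D t U x - U / 2 * x) + b * (energyDensity2D t U y - U / 2 * y) =
      a * energyDensity2D t U x + b * energyDensity2D t U y - U / 2 * (a * x + b * y) := by ring
  rw [e]
  linarith

/-- **`g(n) = e(n) - (U/2) n` is non-increasing on `(0, 1]`** (`μ ≤ U/2` below half filling):
for `0 < x ≤ y ≤ 1`, `y` lies between `x` and its mirror `2 - x`, where `g` takes the same value,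
so convexity gives `g(y) ≤ g(x)`. [cite: LiebWuPhysicaA2003, §7] -/
theorem energyDensity2D_sub_half_mul_antitoneOn (t : ℝ) {U : ℝ} (hU : 0 ≤ U) :
    AntitoneOn (fun n => energyDensity2D t U n - U / 2 * n) (Ioc (0 : ℝ) 1) := by
  intro x hx y hy hxy
  obtain ⟨hx0, hx1⟩ := hx
  obtain ⟨hy0, hy1⟩ := hy
  have hg := convexOn_energyDensity2D_sub_half_mul t hU
  have hxs : x ∈ Ico (0 : ℝ) 2 := ⟨hx0.le, by linarith⟩
  have hx's : 2 - x ∈ Ico (0 : ℝ) 2 := ⟨by linarith, by linarith⟩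
  have hseg : y ∈ segment ℝ x (2 - x) := by
    rw [segment_eq_Icc (by linarith : x ≤ 2 - x)]
    exact ⟨hxy, by linarith⟩
  have h := hg.le_on_segment hxs hx's hseg
  have hsymm := energyDensity2D_sub_half_mul_two_sub t hU hx0 (by linarith : x < 2)
  rw [hsymm, max_self] at h
  exact h

/-- **`g(n) = e(n) - (U/2) n` is non-decreasing on `[1, 2)`** (`μ ≥ U/2` above half filling).
[cite: LiebWuPhysicaA2003, §7] -/
theorem energyDensity2D_sub_half_mul_monotoneOn (t : ℝ) {U : ℝ} (hU : 0 ≤ U) :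
    MonotoneOn (fun n => energyDensity2D t U n - U / 2 * n) (Ico (1 : ℝ) 2) := by
  intro x hx y hy hxy
  obtain ⟨hx1, hx2⟩ := hx
  obtain ⟨hy1, hy2⟩ := hy
  have hg := convexOn_energyDensity2D_sub_half_mul t hU
  have hys : y ∈ Ico (0 : ℝ) 2 := ⟨by linarith, hy2⟩
  have hy's : 2 - y ∈ Ico (0 : ℝ) 2 := ⟨by linarith, by linarith⟩
  have hseg : x ∈ segment ℝ (2 - y) y := by
    rw [segment_eq_Icc (by linarith : 2 - y ≤ y)]
    exact ⟨by linarith, hxy⟩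
  have h := hg.le_on_segment hy's hys hseg
  have hsymm := energyDensity2D_sub_half_mul_two_sub t hU (by linarith : 0 < y) hy2
  rw [hsymm, max_self] at h
  exact h

/-- **The shifted density is minimal at half filling**: `e(1) + (U/2)(n - 1) ≤ e(n)` for every
`0 < n < 2`, `U ≥ 0` — a certified lower bound on `e(1)` is a certified lower bound at every
density up to the explicit linear term (Lieb–Wu: `μ₋ ≤ U/2 ≤ μ₊` at half filling).
[cite: LiebWuPhysicaA2003, §7] -/
theorem energyDensity2D_ge_at_one_add (t : ℝ) {U : ℝ} (hU : 0 ≤ U) {n : ℝ} (hn0 : 0 < n)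
    (hn2 : n < 2) :
    energyDensity2D t U 1 + U / 2 * (n - 1) ≤ energyDensity2D t U n := by
  rcases le_or_gt n 1 with hn1 | hn1
  · have h := energyDensity2D_sub_half_mul_antitoneOn t hU ⟨hn0, hn1⟩ ⟨one_pos, le_rfl⟩ hn1
    simp only at h
    linarith
  · have h := energyDensity2D_sub_half_mul_monotoneOn t hU ⟨le_rfl, one_lt_two⟩ ⟨hn1.le, hn2⟩ hn1.le
    simp only at h
    linarith

/-- **Transport below half filling**: for `0 < x ≤ a ≤ 1` and `U ≥ 0`,
`e(a) - (U/2)(a - x) ≤ e(x)` — e.g. a certified lower bound at `a = 1` (or `a = 7/8`) gives one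
at the smaller density `x`, and a certified upper bound at `x` gives one at `a`.
[cite: LiebWuPhysicaA2003, §7] -/
theorem energyDensity2D_sub_le_of_le_of_le_one (t : ℝ) {U : ℝ} (hU : 0 ≤ U) {x a : ℝ}
    (hx0 : 0 < x) (hxa : x ≤ a) (ha1 : a ≤ 1) :
    energyDensity2D t U a - U / 2 * (a - x) ≤ energyDensity2D t U x := by
  have h := energyDensity2D_sub_half_mul_antitoneOn t hU ⟨hx0, hxa.trans ha1⟩ ⟨hx0.trans_le hxa, ha1⟩
    hxa
  simp only at h
  linarith

/-- **Transport above half filling**: for `1 ≤ x ≤ a < 2` and `U ≥ 0`,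
`e(x) + (U/2)(a - x) ≤ e(a)`. [cite: LiebWuPhysicaA2003, §7] -/
theorem energyDensity2D_sub_le_of_one_le_of_le (t : ℝ) {U : ℝ} (hU : 0 ≤ U) {x a : ℝ}
    (hx1 : 1 ≤ x) (hxa : x ≤ a) (ha2 : a < 2) :
    energyDensity2D t U x + U / 2 * (a - x) ≤ energyDensity2D t U a := by
  have h := energyDensity2D_sub_half_mul_monotoneOn t hU ⟨hx1, hxa.trans_lt ha2⟩ ⟨hx1.trans hxa, ha2⟩
    hxa
  simp only at h
  linarith

end ThermodynamicLimit

end Literature.MathematicalPhysics.QuantumLattice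

end
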